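import Summits.Ventures.Crystal3D.Theorems.StickyWulffConstantStackingLiminfChimeraContent
import HarnessLib

/-!
# Lattice form of the chimera Minkowski content: counting cells (helper toward `StackingLiminf`,
# stmt-Ventures-19145, density Brunn–Minkowski route / line `LayerChain` stub `chimera` (b))

Cell `crystal3d-full`, venture `Summits/Ventures/Crystal3D`.  `Chimera.chimera_stackWulff_content`
(p496790) says: for every height profile `f : ℝ → [0,1]`, every measurable `A ⊆ ℝ³` of finite volume,
every `r > 0` and every measurable `C ⊇ {a + r•w | a ∈ A, w ∈ W_{f(a₂)}}`,
`|A| + 3r|W_0|^{1/3}|A|^{2/3} ≤ |C|` (`W_f = stackWulff f`, `|W_0| = 64√2`).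

Here `A` and `C` are UNIONS OF LATTICE CELLS: fix any linear map `L` of `ℝ³` with `det L ≠ 0` (the frame
of a lattice `L ℤ³`, cell `L [0,1)³` of volume `|det L|`); for finite `U, V ⊆ ℤ³`, if every point
`L(u + p) + r•w` (`u ∈ U`, `p ∈ [0,1)³`, `w` in the stacking Wulff body attached at that point's height)
lies in a cell `L(v + [0,1)³)` with `v ∈ V`, then
`#U + 3 r |W_0|^{1/3} |det L|^{-1/3} (#U)^{2/3} ≤ #V`  (`card_add_content_le_card`, stated in `ℝ≥0∞` with
the cell volume kept explicit: `|det L|·#U + 3r|W_0|^{1/3}(|det L|·#U)^{2/3} ≤ |det L|·#V`).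
For the fcc frame (`|det L| = 1/√2`, `W_0 = ` twice the unit bond zonotope) this is the discrete
Brunn–Minkowski lower bound `#(U + D_t) ≥ N + ∛432 · t · N^{2/3}` for any lattice set `D_t` whose cells
cover `cell + (t/2) W_0` — the lower half of the density-BM sandwich (seat memo `DensityBM.md`, evidence
on stmt-Ventures-19145); the covering hypothesis is kept abstract so that the same statement serves the
word-dependent (chimera) structuring sets.  WHAT THIS IS NOT: any statement about contacts or energies.
-/

noncomputable section

namespace Summit.Ventures.Crystal3D.Theorems

open MeasureTheory Set
open Summit.Ventures.Crystal3D.LayerChain (stackWulff)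
open scoped ENNReal Pointwise

/-- The half-open unit cube `[0,1)³` has volume `1`. -/
theorem volume_unitCube_fin3 :
    volume (Set.pi Set.univ fun _ : Fin 3 => Set.Ico (0 : ℝ) 1) = 1 := by
  rw [Real.volume_pi_Ico]
  simp

/-- Integer translates of the half-open unit cube are disjoint. -/
theorem disjoint_intCast_add_unitCube {u u' : Fin 3 → ℤ} (h : u ≠ u') :
    Disjoint ((fun i => (u i : ℝ)) +ᵥ Set.pi Set.univ fun _ : Fin 3 => Set.Ico (0 : ℝ) 1)
      ((fun i => (u' i : ℝ)) +ᵥ Set.pi Set.univ fun _ : Fin 3 => Set.Ico (0 : ℝ) 1) := by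
  rw [Set.disjoint_left]
  intro x hx hx'
  apply h
  funext i
  rw [Set.mem_vadd_set] at hx hx'
  obtain ⟨p, hp, rfl⟩ := hx
  obtain ⟨p', hp', hpp'⟩ := hx'
  have hpi := (Set.mem_pi.1 hp) i (Set.mem_univ _)
  have hpi' := (Set.mem_pi.1 hp') i (Set.mem_univ _)
  rw [Set.mem_Ico] at hpi hpi'
  have hc : (u' i : ℝ) + p' i = (u i : ℝ) + p i := by
    have := congr_fun hpp' i
    simpa using this
  have h1 : (u i : ℝ) < (u' i : ℝ) + 1 := by linarith
  have h2 : (u' i : ℝ) < (u i : ℝ) + 1 := by linarith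
  have h1' : u i < u' i + 1 := by exact_mod_cast h1
  have h2' : u' i < u i + 1 := by exact_mod_cast h2
  omega

/-- The union of the cells of a finite set of lattice sites (before applying the frame `L`). -/
theorem volume_biUnion_unitCube (U : Finset (Fin 3 → ℤ)) :
    volume (⋃ u ∈ U, ((fun i => (u i : ℝ)) +ᵥ Set.pi Set.univ fun _ : Fin 3 => Set.Ico (0 : ℝ) 1)) =
      (U.card : ℝ≥0∞) := by
  rw [measure_biUnion_finset]
  · simp_rw [measure_vadd, volume_unitCube_fin3]
    rw [Finset.sum_const, nsmul_eq_mul, mul_one]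
  · intro u _ u' _ h
    exact disjoint_intCast_add_unitCube h
  · intro u _
    exact (MeasurableSet.univ_pi fun _ => measurableSet_Ico).const_vadd _

/-- The union of unit cells over a finite set of sites is measurable. -/
theorem measurableSet_biUnion_unitCube (U : Finset (Fin 3 → ℤ)) :
    MeasurableSet (⋃ u ∈ U, ((fun i => (u i : ℝ)) +ᵥ
      Set.pi Set.univ fun _ : Fin 3 => Set.Ico (0 : ℝ) 1)) :=
  MeasurableSet.biUnion (Finset.countable_toSet U) fun _ _ =>
    (MeasurableSet.univ_pi fun _ => measurableSet_Ico).const_vadd _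

/-- Image of a measurable set under a linear map with non-zero determinant is measurable. -/
theorem measurableSet_image_of_det_ne_zero (L : (Fin 3 → ℝ) →ₗ[ℝ] (Fin 3 → ℝ))
    (hL : LinearMap.det L ≠ 0) {S : Set (Fin 3 → ℝ)} (hS : MeasurableSet S) :
    MeasurableSet (L '' S) := by
  let g := (L.equivOfDetNeZero hL).toContinuousLinearEquiv
  have : L '' S = g '' S := rfl
  rw [this, ContinuousLinearEquiv.image_eq_preimage_symm]
  exact g.symm.continuous.measurable hS

/-- **Lattice form of the chimera Minkowski content.**  Frame `L` (any linear map of `ℝ³` with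
`det L ≠ 0`, cells `L(v + [0,1)³)` of volume `|det L|`), height profile `f : ℝ → [0,1]`, `r > 0`, finite
site sets `U, V ⊆ ℤ³`.  If for every `u ∈ U`, every `p ∈ [0,1)³` and every `w` in the stacking Wulff body
`W_{f(h)}` attached at the height `h = (L(u+p))₂` of the point, the point `L(u + p) + r•w` lies in some
cell `L(v + [0,1)³)`, `v ∈ V`, then
`|det L|·#U + 3·(r|W_0|^{1/3})·(|det L|·#U)^{2/3} ≤ |det L|·#V`. -/
theorem card_add_content_le_card (L : (Fin 3 → ℝ) →ₗ[ℝ] (Fin 3 → ℝ)) (hL : LinearMap.det L ≠ 0)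
    {f : ℝ → ℝ} (hf : ∀ t, 0 ≤ f t ∧ f t ≤ 1) {r : ℝ} (hr : 0 < r) (U V : Finset (Fin 3 → ℤ))
    (hcov : ∀ u ∈ U, ∀ p ∈ Set.pi Set.univ (fun _ : Fin 3 => Set.Ico (0 : ℝ) 1),
      ∀ w ∈ stackWulff (f ((L ((fun i => (u i : ℝ)) + p)) 2)),
        ∃ v ∈ V, ∃ q ∈ Set.pi Set.univ (fun _ : Fin 3 => Set.Ico (0 : ℝ) 1),
          L ((fun i => (u i : ℝ)) + p) + r • w = L ((fun i => (v i : ℝ)) + q)) :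
    ENNReal.ofReal |LinearMap.det L| * U.card +
        3 * (ENNReal.ofReal r * volume (stackWulff 0) ^ ((3 : ℕ)⁻¹ : ℝ)) *
          (ENNReal.ofReal |LinearMap.det L| * U.card) ^ ((2 : ℝ) / 3) ≤
      ENNReal.ofReal |LinearMap.det L| * V.card := by
  set Q : Set (Fin 3 → ℝ) := Set.pi Set.univ fun _ : Fin 3 => Set.Ico (0 : ℝ) 1 with hQ
  set SU : Set (Fin 3 → ℝ) := ⋃ u ∈ U, ((fun i => (u i : ℝ)) +ᵥ Q) with hSU
  set SV : Set (Fin 3 → ℝ) := ⋃ v ∈ V, ((fun i => (v i : ℝ)) +ᵥ Q) with hSV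
  have hA : MeasurableSet (L '' SU) :=
    measurableSet_image_of_det_ne_zero L hL (measurableSet_biUnion_unitCube U)
  have hC : MeasurableSet (L '' SV) :=
    measurableSet_image_of_det_ne_zero L hL (measurableSet_biUnion_unitCube V)
  have hvolA : volume (L '' SU) = ENNReal.ofReal |LinearMap.det L| * U.card := by
    rw [MeasureTheory.Measure.addHaar_image_linearMap, volume_biUnion_unitCube]
  have hvolC : volume (L '' SV) = ENNReal.ofReal |LinearMap.det L| * V.card := by
    rw [MeasureTheory.Measure.addHaar_image_linearMap, volume_biUnion_unitCube]
  have hAt : volume (L '' SU) ≠ ⊤ := by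
    rw [hvolA]
    exact ENNReal.mul_ne_top ENNReal.ofReal_ne_top (ENNReal.natCast_ne_top _)
  have hsub : ∀ a ∈ L '' SU, ∀ w ∈ stackWulff (f (a 2)), a + r • w ∈ L '' SV := by
    intro a ha w hw
    obtain ⟨x, hx, rfl⟩ := ha
    rw [hSU, Set.mem_iUnion₂] at hx
    obtain ⟨u, hu, hxu⟩ := hx
    rw [Set.mem_vadd_set] at hxu
    obtain ⟨p, hp, rfl⟩ := hxu
    obtain ⟨v, hv, q, hq, hvq⟩ := hcov u hu p hp w hw
    refine ⟨(fun i => (v i : ℝ)) + q, ?_, ?_⟩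
    · rw [hSV, Set.mem_iUnion₂]
      exact ⟨v, hv, Set.mem_vadd_set.2 ⟨q, hq, rfl⟩⟩
    · rw [← hvq]
      rfl
  have h := Chimera.chimera_stackWulff_content hf hA hC hr hsub hAt
  rwa [hvolA, hvolC] at h

end Summit.Ventures.Crystal3D.Theorems

end
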